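import Literature.Barriers.Schanuel.AlgebraicIndependenceOfLogarithmsRoyThm3
import HarnessLib

/-!
# Barrier (Schanuel): Roy 1992, Theorem 2bis — the abstract deduction from Statement 2′

Fifth companion on the chain behind the named fact
`Literature.Barriers.Schanuel.roy1992_strongSixExponentials` (Roy 1992, §4 Corollary 2), on the
layer **Theorem 1 (M. Waldschmidt) ⇒ Theorem 2** ([Roy1992], §§2–3; the two theorems are the
named facts `roy1992_thm1`, `roy1992_thm2` of
`Literature.Barriers.Schanuel.AlgebraicIndependenceOfLogarithmsRoyThm12`). The previous companion
`Literature.Barriers.Schanuel.AlgebraicIndependenceOfLogarithmsRoyThm3` proves Roy's abstract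
Theorem 3 (four equivalent statements about functions `a, b, c, d, r : Ob(𝒞) → ℕ` on an admissible
category). Roy's printed "Proof of Theorem 2bis" (pp. 32–34) is itself almost entirely abstract:
besides Theorem 3 (Statement 1 ⇒ Statement 2′) it uses only that the extra function `d₁` is
additive, that `a ≤ d₁`, and Proposition 3 ("for each object `X` of `𝒞`, there exists a cokernel
`s : X → X'` with domain `X` such that `d₁(X') ≤ a(X)` and `b(X') = b(X)`"). This file proves
Theorem 2bis in exactly that generality, for any `Roy1992.AdmissibleCat` — so that the concrete
deduction `roy1992_thm1 → roy1992_thm2` only has to supply Roy's category of §2 with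
Propositions 1–3 (linear algebra) and read the result off.

## What the source prints [Roy1992]

* (§2, p. 27) `a(X) = d₁ − dim_ℚ(Y ∩ Ω)`, `b(X) = d₀ + d₁ − dim_K(V)`, `c(X) = dim_ℚ(Y)`,
  `d(X) = dim_K(V/W)`, `r(X) = d₀ + d₁`, `d₀(X) = d₀`, `d₁(X) = d₁`.
  **Theorem 2bis.** "Let `X` be an object of `𝒞` with `b(X) ≠ 0`. Consider, among the set of
  cokernels `s : X → X'` of `𝒞` with domain `X`, with `b(X') ≠ 0`, those for which the ratio
  `d₁(X')/b(X')` is minimal. This subset is not empty and contains at least one cokernel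
  `s : X → X'` for which there does not exist in `𝒞` any kernel `i : X* → X'` with codomain `X'`
  such that `d₁(X*) = b(X*) = 0` and `r(X*) ≠ 0`. For such a cokernel, we have
  `(d₁(X') + c(X'))/(b(X') + d(X')) ≤ d₁(X')/b(X') ≤ a(X)/b(X)`."
* (§2, p. 28) **Proposition 2.** "The function `a` is upper additive while `b, c, d, r, d₀`, and
  `d₁` are additive. These functions vanish on each object on which `r` vanishes."
  **Proposition 3.** "The function `a` is bounded above by `d₁`. For each object `X` of `𝒞`, there
  exists a cokernel `s : X → X'` with domain `X` such that `d₁(X') ≤ a(X)` and `b(X') = b(X)`."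
* (§3, pp. 32–34) **Proof of Theorem 2bis.** "By Propositions 1 and 2, they fulfil the conditions
  of Theorem 3. Moreover … Statement 1 is true since it is Theorem 1bis. Therefore … Statement 2′
  is true. Let `X` be an object of `𝒞` such that `b(X) ≠ 0`. The set `E` of all cokernels
  `s : X → X'` with domain `X` with `b(X') ≠ 0` is not empty since it contains the identity
  morphism of `X` … The set of ratios `a(X')/b(X')` … possesses a minimum `μ₀`, and the set `E₀` …
  is not empty. Likewise, for the function `d₁` … a minimum `μ₁`, and the set `E₁` … By
  Proposition 3, there exists, for each element `s : X → X'` of `E`, a cokernel `s' : X' → X''`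
  … such that `d₁(X'') ≤ a(X')` and `b(X'') = b(X')`. Then … `s' ∘ s` also belongs to `E`.
  Applying this argument to an element `s` of `E₀`, we get `μ₁ ≤ μ₀`. Applying it to an element
  `s` of `E₁`, and taking into account the inequality `a(X') ≤ d₁(X')`, we get `a(X') = d₁(X')`.
  This last result together with the inequality `μ₁ ≤ μ₀` gives `μ₁ = μ₀` and `E₁ ⊂ E₀`.
  [first assertion] we choose in `E₁` a cokernel `s : X → X'` for which `r(X')` is minimal … let
  `i : X* → X'` be a kernel with codomain `X'` such that `d₁(X*) = b(X*) = 0`, and let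
  `s' : X' → X''` be a cokernel of `i`. Since `d₁` and `b` are additive, we get `d₁(X'') = d₁(X')`
  and `b(X'') = b(X')`. Thus … `s' ∘ s` … belongs to `E₁`. Given the choice of `s`, this implies
  `r(X'') ≥ r(X')`. Then, `r` being additive, we get `r(X*) = 0` …
  [second assertion] Let `s : X → X'` be an element of `E₁` for which there does not exist any
  kernel … We first show that `X'` fulfils the conditions of Statement 2′ if `c(X') ≠ 0`. Since
  `E₁ ⊂ E₀`, we have `s ∈ E₀`. This ensures the first condition. Let `i : X* → X'` be a kernel of
  `𝒞` with codomain `X'` such that `b(X*) = 0` … it suffices to show `r(X*) = 0` … let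
  `s' : X' → X''` be a cokernel of `i`. Since `b` is additive, we have `b(X'') = b(X')`. Thus
  `s' ∘ s` belongs to `E`. Since `s ∈ E₁`, this implies `d₁(X'') ≥ d₁(X')`, whence `d₁(X*) = 0`
  because `d₁` is additive. The choice of `s` therefore implies `r(X*) = 0` … If `c(X') ≠ 0`,
  Statement 2′ thus applies to `X'`, and gives `d(X') ≠ 0` and `c(X')/d(X') ≤ a(X')/b(X')`. From
  this we deduce `(a(X') + c(X'))/(b(X') + d(X')) ≤ a(X')/b(X')` whatever `c(X')` is. Since the
  identity morphism of `X` belongs to `E`, we also have `a(X')/b(X') ≤ a(X)/b(X)`. Finally, since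
  `s ∈ E₁`, we have `a(X') = d₁(X')`."

## Lean rendering

Everything is stated for an arbitrary `𝒞 : Roy1992.AdmissibleCat Obj` (the arrow-free admissible
category of the previous companion) and functions `a b c d r d₁ : Obj → ℕ`, with ratios in `ℝ`
exactly as in `Statement1`/`Statement2'` there. "`s : X → X'` is in `E`" is
`𝒞.IsCoker X X' ∧ b X' ≠ 0`; "`s ∈ E₁`" adds the minimality of `d₁(X')/b(X')` over `E`; the
kernel condition is `¬ ∃ A, 𝒞.IsKer A X' ∧ d₁ A = 0 ∧ b A = 0 ∧ r A ≠ 0`. The hypotheses of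
Proposition 3 and `a ≤ d₁` are taken as explicit assumptions (`hP3`, `had₁`), Proposition 2 as
`𝒞.Thm3Hyp a b c d r` plus `𝒞.Additive d₁`, and Theorem 1bis as `𝒞.Statement1 a b c d r`.
Theorems: `Roy1992.AdmissibleCat.eq_and_min_of_min_d₁` ("`a(X') = d₁(X')`" and "`E₁ ⊂ E₀`"),
`Roy1992.AdmissibleCat.thm2bis_exists` (first assertion), `Roy1992.AdmissibleCat.thm2bis_ineq`
(second assertion, from Statement 2′), and `Roy1992.AdmissibleCat.thm2bis` (both, from
Statement 1 via Theorem 3). No new definitions, no named facts.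

## References

* [Roy1992] D. Roy, *Matrices whose coefficients are linear forms in logarithms*, J. Number
  Theory 41 (1992) 22–47: §2 (functions `a, b, c, d, r, d₀, d₁`, Theorem 2bis, Propositions 2–3,
  pp. 27–29); §3 (proof of Theorem 2bis, pp. 32–34).
-/

noncomputable section

namespace Literature.Barriers.Schanuel.Roy1992.AdmissibleCat

variable {Obj : Type*} {𝒞 : AdmissibleCat Obj} {a b c d r d₁ : Obj → ℕ}

/-! ### `μ₁ = μ₀`, `E₁ ⊂ E₀` and `a(X') = d₁(X')` on `E₁` -/

/-- **First paragraph of the proof of Theorem 2bis** (p. 33). If the cokernel `X → X'` lies in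
`E₁` (it minimises `d₁(X')/b(X')` among the cokernels `X → X''` with `b(X'') ≠ 0`), then
`a(X') = d₁(X')` and `X'` also minimises `a/b` on `E` (`μ₁ = μ₀`, `E₁ ⊂ E₀`): by Proposition 3
every `X'' ∈ E` has a cokernel `X'' → X'''` in `E` with `d₁(X''')/b(X''') ≤ a(X'')/b(X'')`, and
`a ≤ d₁`. [cite: Roy1992, §3 proof of Theorem 2bis (p. 33)] -/
theorem eq_and_min_of_min_d₁ (had₁ : ∀ X, a X ≤ d₁ X)
    (hP3 : ∀ X, ∃ X', 𝒞.IsCoker X X' ∧ d₁ X' ≤ a X ∧ b X' = b X)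
    {X X' : Obj} (hX'C : 𝒞.IsCoker X X') (hbX' : b X' ≠ 0)
    (hmin : ∀ X'', 𝒞.IsCoker X X'' → b X'' ≠ 0 → (d₁ X' : ℝ) / b X' ≤ (d₁ X'' : ℝ) / b X'') :
    a X' = d₁ X' ∧
      ∀ X'', 𝒞.IsCoker X X'' → b X'' ≠ 0 → (a X' : ℝ) / b X' ≤ (a X'' : ℝ) / b X'' := by
  -- Proposition 3 along `E`: every `X'' ∈ E` is followed by some `X''' ∈ E` with
  -- `d₁(X''')/b(X''') ≤ a(X'')/b(X'')`, hence `d₁(X')/b(X') ≤ a(X'')/b(X'')`.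
  have key : ∀ X'', 𝒞.IsCoker X X'' → b X'' ≠ 0 → (d₁ X' : ℝ) / b X' ≤ (a X'' : ℝ) / b X'' := by
    intro X'' hX''C hbX''
    obtain ⟨X''', hC, hd₁le, hbeq⟩ := hP3 X''
    have hbX''' : b X''' ≠ 0 := by rw [hbeq]; exact hbX''
    have hbpos : (0 : ℝ) < b X'' := by exact_mod_cast Nat.pos_of_ne_zero hbX''
    refine (hmin X''' (𝒞.isCoker_trans hX''C hC) hbX''').trans ?_
    have hbcast : (b X''' : ℝ) = b X'' := by exact_mod_cast hbeq
    rw [hbcast, div_le_div_iff_of_pos_right hbpos]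
    exact_mod_cast hd₁le
  have hbpos : (0 : ℝ) < b X' := by exact_mod_cast Nat.pos_of_ne_zero hbX'
  -- at `X'' = X'`: `d₁(X') ≤ a(X') ≤ d₁(X')`
  have hle : (d₁ X' : ℝ) ≤ a X' := by
    have := key X' hX'C hbX'
    rwa [div_le_div_iff_of_pos_right hbpos] at this
  have heq : a X' = d₁ X' := le_antisymm (had₁ X') (by exact_mod_cast hle)
  refine ⟨heq, fun X'' hX''C hbX'' => ?_⟩
  rw [heq]
  exact key X'' hX''C hbX''

/-! ### First assertion: a minimiser without bad kernels -/

/-- **Theorem 2bis, first assertion** (p. 33): if `b(X) ≠ 0`, the set `E₁` of cokernels `X → X'`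
with `b(X') ≠ 0` minimising `d₁(X')/b(X')` is not empty and contains one for which there is no
kernel `X* → X'` with `d₁(X*) = b(X*) = 0` and `r(X*) ≠ 0` — namely any element of `E₁` with
`r(X')` minimal: a kernel `X* → X'` with `d₁(X*) = b(X*) = 0` has a cokernel `X' → X''` with
`d₁(X'') = d₁(X')`, `b(X'') = b(X')` (additivity), so `X → X''` is again in `E₁`,
`r(X'') ≥ r(X')`, and `r(X*) = 0`. Only the additivity of `b`, `r`, `d₁` is used.
[cite: Roy1992, §2 Theorem 2bis (p. 27); §3 proof of Theorem 2bis, first assertion (p. 33)] -/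
theorem thm2bis_exists (H : 𝒞.Thm3Hyp a b c d r) (hd₁ : 𝒞.Additive d₁) (X : Obj) (hbX : b X ≠ 0) :
    ∃ X', (𝒞.IsCoker X X' ∧ b X' ≠ 0 ∧
        ∀ X'', 𝒞.IsCoker X X'' → b X'' ≠ 0 → (d₁ X' : ℝ) / b X' ≤ (d₁ X'' : ℝ) / b X'') ∧
      ¬ ∃ A, 𝒞.IsKer A X' ∧ d₁ A = 0 ∧ b A = 0 ∧ r A ≠ 0 := by
  -- `E` (as a predicate), a minimiser `X₁` of `d₁/b` on `E`, `E₁`, and `X' ∈ E₁` with `r` minimal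
  set P : Obj → Prop := fun X' => 𝒞.IsCoker X X' ∧ b X' ≠ 0 with hP
  have hPX : P X := ⟨𝒞.isCoker_refl X, hbX⟩
  obtain ⟨X₁, hPX₁, hX₁min⟩ := exists_min_ratio P d₁ b (d₁ X) (b X)
    (fun A hA => ⟨hd₁.le_of_isCoker hA.1, H.hb.le_of_isCoker hA.1⟩) hPX
  set P₁ : Obj → Prop := fun X' => P X' ∧ (d₁ X' : ℝ) / b X' ≤ (d₁ X₁ : ℝ) / b X₁ with hP₁
  obtain ⟨X', ⟨hPX', hX'le⟩, hrmin⟩ := exists_min_nat P₁ r (X₀ := X₁) ⟨hPX₁, le_rfl⟩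
  refine ⟨X', ⟨hPX'.1, hPX'.2, fun X'' hC hb => hX'le.trans (hX₁min X'' ⟨hC, hb⟩)⟩, ?_⟩
  rintro ⟨A, hAK, hd₁A, hbA, hrA⟩
  obtain ⟨X'', hE⟩ := 𝒞.exists_exact_of_isKer hAK
  have hd₁'' : d₁ X'' = d₁ X' := by have := hd₁ hE; omega
  have hb'' : b X'' = b X' := by have := H.hb hE; omega
  have hX''C : 𝒞.IsCoker X X'' := 𝒞.isCoker_trans hPX'.1 (𝒞.isCoker_of_exact hE)
  have hPX'' : P X'' := ⟨hX''C, by rw [hb'']; exact hPX'.2⟩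
  have hP₁X'' : P₁ X'' := by
    refine ⟨hPX'', ?_⟩
    have h1 : (d₁ X'' : ℝ) = d₁ X' := by exact_mod_cast hd₁''
    have h2 : (b X'' : ℝ) = b X' := by exact_mod_cast hb''
    rw [h1, h2]
    exact hX'le
  have hrle : r X' ≤ r X'' := hrmin X'' hP₁X''
  have hradd : r X' = r A + r X'' := H.hr hE
  exact hrA (by omega)

/-! ### Second assertion: the two inequalities -/

/-- **Theorem 2bis, second assertion** (pp. 33–34), from Statement 2′: if `X → X'` is in `E₁` and
`X'` has no kernel `X* → X'` with `d₁(X*) = b(X*) = 0`, `r(X*) ≠ 0`, then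
`(d₁(X') + c(X'))/(b(X') + d(X')) ≤ d₁(X')/b(X') ≤ a(X)/b(X)`. If `c(X') ≠ 0`, `X'` satisfies the
hypotheses of Statement 2′ (`E₁ ⊂ E₀` gives the cokernel condition; a kernel `X* → X'` with
`b(X*) = 0` has a cokernel `X' → X''` in `E` with `b(X'') = b(X')`, so `d₁(X'') ≥ d₁(X')`,
`d₁(X*) = 0`, and then `r(X*) = 0` by the choice of `X'`), whence `d(X') ≠ 0`,
`c(X')/d(X') ≤ a(X')/b(X')` and the mediant inequality; if `c(X') = 0` the first inequality is
trivial; finally `a(X') = d₁(X')` and `a(X')/b(X') ≤ a(X)/b(X)` (the identity is in `E`).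
[cite: Roy1992, §2 Theorem 2bis (p. 27); §3 proof of Theorem 2bis, second assertion (pp. 33–34)] -/
theorem thm2bis_ineq (H : 𝒞.Thm3Hyp a b c d r) (hd₁ : 𝒞.Additive d₁) (had₁ : ∀ X, a X ≤ d₁ X)
    (hP3 : ∀ X, ∃ X', 𝒞.IsCoker X X' ∧ d₁ X' ≤ a X ∧ b X' = b X)
    (h2' : 𝒞.Statement2' a b c d r) {X X' : Obj} (hbX : b X ≠ 0)
    (hX'C : 𝒞.IsCoker X X') (hbX' : b X' ≠ 0)
    (hmin : ∀ X'', 𝒞.IsCoker X X'' → b X'' ≠ 0 → (d₁ X' : ℝ) / b X' ≤ (d₁ X'' : ℝ) / b X'')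
    (hno : ¬ ∃ A, 𝒞.IsKer A X' ∧ d₁ A = 0 ∧ b A = 0 ∧ r A ≠ 0) :
    ((d₁ X' : ℝ) + c X') / ((b X' : ℝ) + d X') ≤ (d₁ X' : ℝ) / b X' ∧
      (d₁ X' : ℝ) / b X' ≤ (a X : ℝ) / b X := by
  obtain ⟨haeq, hE₀⟩ := eq_and_min_of_min_d₁ had₁ hP3 hX'C hbX' hmin
  have hbX'pos : (0 : ℝ) < b X' := by exact_mod_cast Nat.pos_of_ne_zero hbX'
  have hacast : (a X' : ℝ) = d₁ X' := by exact_mod_cast haeq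
  refine ⟨?_, ?_⟩
  · -- `(a(X') + c(X'))/(b(X') + d(X')) ≤ a(X')/b(X')`, with `a(X') = d₁(X')`
    rw [← hacast]
    have hbdpos : (0 : ℝ) < (b X' : ℝ) + d X' := by positivity
    rw [div_le_div_iff₀ hbdpos hbX'pos]
    -- goal: `(a + c) b ≤ a (b + d)`, i.e. `c b ≤ a d`
    by_cases hcX' : c X' = 0
    · rw [hcX', Nat.cast_zero, add_zero]
      have h0 : (0 : ℝ) ≤ (a X' : ℝ) * d X' := by positivity
      nlinarith
    · -- Statement 2′ at `X'`
      rw [statement2'_iff] at h2'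
      have hcoker : ∀ X'', 𝒞.IsCoker X' X'' → b X'' ≠ 0 →
          (a X' : ℝ) / b X' ≤ (a X'' : ℝ) / b X'' :=
        fun X'' hC hb => hE₀ X'' (𝒞.isCoker_trans hX'C hC) hb
      have hker : ¬ ∃ A, 𝒞.IsKer A X' ∧ a A = 0 ∧ b A = 0 ∧ r A ≠ 0 := by
        rintro ⟨A, hAK, -, hbA, hrA⟩
        refine hno ⟨A, hAK, ?_, hbA, hrA⟩
        -- `d₁(X*) = 0`: a cokernel `X' → X''` of the kernel has `b(X'') = b(X')`, lies in `E`,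
        -- so `d₁(X') ≤ d₁(X'')`, while `d₁(X') = d₁(X*) + d₁(X'')`
        obtain ⟨X'', hE⟩ := 𝒞.exists_exact_of_isKer hAK
        have hb'' : b X'' = b X' := by have := H.hb hE; omega
        have hbX'' : b X'' ≠ 0 := by rw [hb'']; exact hbX'
        have hX''C : 𝒞.IsCoker X X'' := 𝒞.isCoker_trans hX'C (𝒞.isCoker_of_exact hE)
        have hratio := hmin X'' hX''C hbX''
        have hbcast : (b X'' : ℝ) = b X' := by exact_mod_cast hb''
        rw [hbcast, div_le_div_iff_of_pos_right hbX'pos] at hratio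
        have hd₁le : d₁ X' ≤ d₁ X'' := by exact_mod_cast hratio
        have hd₁add : d₁ X' = d₁ A + d₁ X'' := hd₁ hE
        omega
      obtain ⟨hdX', hcd⟩ := h2' X' hbX' hcX' hcoker hker
      have hdX'pos : (0 : ℝ) < d X' := by exact_mod_cast Nat.pos_of_ne_zero hdX'
      rw [div_le_div_iff₀ hdX'pos hbX'pos] at hcd
      -- `hcd : c b ≤ a d`
      nlinarith
  · -- `d₁(X')/b(X') = a(X')/b(X') ≤ a(X)/b(X)` since the identity of `X` is in `E`
    rw [← hacast]
    exact hE₀ X (𝒞.isCoker_refl X) hbX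

/-! ### Theorem 2bis -/

/-- **Roy 1992, Theorem 2bis** in an admissible category: if `a, d` are upper additive,
`b, c, r, d₁` additive, `a, b, c, d` vanish where `r` does (Proposition 2), `a ≤ d₁` and every
object has a cokernel `X → X'` with `d₁(X') ≤ a(X)`, `b(X') = b(X)` (Proposition 3), and
Statement 1 holds (Theorem 1bis), then for every `X` with `b(X) ≠ 0`: (i) among the cokernels
`X → X'` with `b(X') ≠ 0` minimising `d₁(X')/b(X')` there is one admitting no kernel `X* → X'`
with `d₁(X*) = b(X*) = 0`, `r(X*) ≠ 0`; (ii) for every such cokernel,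
`(d₁(X') + c(X'))/(b(X') + d(X')) ≤ d₁(X')/b(X') ≤ a(X)/b(X)`. Proof as printed: Theorem 3 gives
Statement 2′ (`statement2'_of_statement1`), then `thm2bis_exists` and `thm2bis_ineq`.
[cite: Roy1992, §2 Theorem 2bis (p. 27); §3 proof of Theorem 2bis (pp. 32–34)] -/
theorem thm2bis (H : 𝒞.Thm3Hyp a b c d r) (hd₁ : 𝒞.Additive d₁) (had₁ : ∀ X, a X ≤ d₁ X)
    (hP3 : ∀ X, ∃ X', 𝒞.IsCoker X X' ∧ d₁ X' ≤ a X ∧ b X' = b X)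
    (h1 : 𝒞.Statement1 a b c d r) (X : Obj) (hbX : b X ≠ 0) :
    (∃ X', (𝒞.IsCoker X X' ∧ b X' ≠ 0 ∧
        ∀ X'', 𝒞.IsCoker X X'' → b X'' ≠ 0 → (d₁ X' : ℝ) / b X' ≤ (d₁ X'' : ℝ) / b X'') ∧
      ¬ ∃ A, 𝒞.IsKer A X' ∧ d₁ A = 0 ∧ b A = 0 ∧ r A ≠ 0) ∧
    ∀ X', 𝒞.IsCoker X X' → b X' ≠ 0 →
      (∀ X'', 𝒞.IsCoker X X'' → b X'' ≠ 0 → (d₁ X' : ℝ) / b X' ≤ (d₁ X'' : ℝ) / b X'') →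
      (¬ ∃ A, 𝒞.IsKer A X' ∧ d₁ A = 0 ∧ b A = 0 ∧ r A ≠ 0) →
      ((d₁ X' : ℝ) + c X') / ((b X' : ℝ) + d X') ≤ (d₁ X' : ℝ) / b X' ∧
        (d₁ X' : ℝ) / b X' ≤ (a X : ℝ) / b X :=
  ⟨thm2bis_exists H hd₁ X hbX, fun _ hX'C hbX' hmin hno =>
    thm2bis_ineq H hd₁ had₁ hP3 (statement2'_of_statement1 H h1) hbX hX'C hbX' hmin hno⟩

end Literature.Barriers.Schanuel.Roy1992.AdmissibleCat
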